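import Mathlib.Analysis.SpecialFunctions.Pow.Deriv
import Literature.MathematicalPhysics.KineticTheory.HardSphereEuler
import Literature.Analysis.FluidPDE.CompressibleEulerImplosion
import Literature.Analysis.FunctionSpaces.TorusChainRule
import Literature.Barriers.AtomisticToContinuum.DiluteRegime

/-!
# The isentropic → full ideal-gas bridge at reduced density `σ = 0`

Helper toward the stub `stub_typeOneImplosion` of the line `log-lipschitz-budget` (crux
`ImplosionDichotomy.PolynomialCompression`, stmt-AtomisticToContinuum-12587) and toward the route
support `ImplosionDichotomy.IdealGasImplosion` (stmt-AtomisticToContinuum-12588).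

`Literature.Analysis.FluidPDE.CompressibleEulerImplosion` vendors the Cao-Labora–Gómez-Serrano–
Shi–Staffilani implosion as a classical solution of the ISENTROPIC system
`Literature.Analysis.FluidPDE.IsIsentropicEulerSolution γ T ρ u` (mass equation and the
NON-conservative momentum equation `ρ ∂ₜu + ρ (u·∇)u + ∇(ρ^γ/γ) = 0`) and says verbatim: "the bridge
to the full (non-isentropic) ideal-gas system `IsHardSphereEulerSolution 0` via `θ := ρ^{γ−1}/γ` is
left to provers". This file proves that bridge for the monatomic exponent `γ = 5/3`:

* `isHardSphereEulerSolution_zero_of_isentropic` — if `(ρ, u)` is a classical isentropic solution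
  with `γ = 5/3` on `[0,T) × 𝕋³`, then `(ρ, u, θ)` with `θ := (3/5) ρ^{2/3}` is a classical solution
  of the FULL hard-sphere Euler system at `σ = 0` (`hsPressure 0 ρ θ = ρ θ`, the monatomic ideal
  gas): smoothness and positivity of `θ`, the CONSERVATIVE momentum equation
  `∂ₜ(ρu) + ∑ᵢ ∂ᵢ(ρ uᵢ u) + ∇p = 0` (`= u · (mass) + (non-conservative momentum)`), and the energy
  equation `∂ₜE + div((E + p)u) = 0` for `E = ρ(|u|²/2 + 3θ/2) = ρ|u|²/2 + (9/10)ρ^{5/3}`,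
  `p = ρθ = (3/5)ρ^{5/3} = ρ^γ/γ` (`= (|u|²/2 + (3/2)ρ^{2/3}) · (mass) + ∑ₖ uₖ · (momentum)ₖ`).

The pointwise calculus is the tree's torus calculus (`TorusCalculusProofs`, `TorusChainRule`,
`TorusSpaceTime`): Leibniz rules for `Torus.timeDerivWithin`, `Torus.partialDeriv`,
`Torus.divergence`, plus a pointwise chain rule `∂ᵢ(φ ∘ w) = φ'(w) ∂ᵢw` for the powers `ρ^{2/3}`,
`ρ^{5/3}` (Mathlib `Real.hasDerivAt_rpow_const`); the ideal-gas law at `σ = 0`,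
`hsPressure 0 ρ θ = ρ θ`, is `Literature.Barriers.AtomisticToContinuum.hsPressure_zero`.
-/

noncomputable section

namespace Summit.AtomisticToContinuum.HydrodynamicLimit.Theorems

open Set MeasureTheory Filter
open scoped ContDiff InnerProductSpace
open Literature.MathematicalPhysics.KineticTheory
open Literature.Analysis.FunctionSpaces Literature.Analysis.FunctionSpaces.Torus
open Literature.Analysis.FluidPDE (IsIsentropicEulerSolution)
open Literature.Barriers.AtomisticToContinuum (hsPressure_zero)

/-! ## Scalar identities -/

/-- `r^{5/3} = r · r^{2/3}` for `r > 0`. [folklore] -/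
theorem rpow_five_thirds {r : ℝ} (hr : 0 < r) : r ^ (5 / 3 : ℝ) = r * r ^ (2 / 3 : ℝ) := by
  rw [show (5 / 3 : ℝ) = 2 / 3 + 1 by norm_num, Real.rpow_add_one hr.ne', mul_comm]

/-- `r^{2/3 - 1} · r = r^{2/3}` for `r > 0`. [folklore] -/
theorem rpow_two_thirds_sub_one_mul {r : ℝ} (hr : 0 < r) :
    r ^ (2 / 3 - 1 : ℝ) * r = r ^ (2 / 3 : ℝ) := by
  rw [Real.rpow_sub_one hr.ne', div_mul_cancel₀ _ hr.ne']

/-! ## Pointwise torus calculus -/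

/-- Chain rule along coordinate lines, pointwise: `∂ᵢ(φ ∘ w)(x) = φ'(w x) ∂ᵢw(x)` for a `C¹` scalar
`w` on the torus and `φ : ℝ → ℝ` differentiable at `w x`. [folklore] -/
-- adapted from Literature/Analysis/FluidPDE/TorusHeatLrEstimate.lean (`partialDeriv_comp_apply`)
theorem partialDeriv_comp_of_hasDerivAt {φ : ℝ → ℝ} {φ' : ℝ} {w : T3 → ℝ} (hw : IsContDiff 1 w)
    (x : T3) (hφ : HasDerivAt φ φ' (w x)) (i : Fin 3) :
    partialDeriv i (fun z => φ (w z)) x = φ' * partialDeriv i w x := by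
  have hin := hasDerivAt_comp_add_proj_smul hw x (EuclideanSpace.single i (1 : ℝ)) 0
  have hx0 : x + proj ((0 : ℝ) • EuclideanSpace.single i (1 : ℝ)) = x := by
    rw [zero_smul, proj_zero, add_zero]
  rw [hx0] at hin
  have h := hφ.comp_of_eq (0 : ℝ) hin (by simp only [zero_smul, proj_zero, add_zero])
  change deriv (fun t : ℝ => φ (w (x + proj (t • EuclideanSpace.single i (1 : ℝ))))) 0 =
    φ' * deriv (fun t : ℝ => w (x + proj (t • EuclideanSpace.single i (1 : ℝ)))) 0
  rw [hin.deriv]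
  exact h.deriv

/-- `∂ᵢ(f + g)(x) = ∂ᵢf(x) + ∂ᵢg(x)` (lambda form of `Torus.partialDeriv_add`). [folklore] -/
-- adapted from Literature/Analysis/FluidPDE/ClassicalEulerPointData.lean (`partialDeriv_add_apply`)
theorem partialDeriv_add_apply {F : Type*} [NormedAddCommGroup F] [NormedSpace ℝ F]
    {f g : T3 → F} (hf : IsContDiff 1 f) (hg : IsContDiff 1 g) (i : Fin 3) (x : T3) :
    partialDeriv i (fun y => f y + g y) x = partialDeriv i f x + partialDeriv i g x := by
  change partialDeriv i (f + g) x = _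
  rw [partialDeriv_add hf hg i]
  rfl

/-- Coordinates of the torus gradient of a `C¹` scalar: `(∇θ)(x)ⱼ = ∂ⱼθ(x)`. [folklore] -/
-- adapted from Literature/Analysis/FunctionSpaces/TorusMollifierEstimates.lean (`gradient_apply`)
theorem gradient_apply_coord {θ : T3 → ℝ} (hθ : IsContDiff 1 θ) (x : T3) (j : Fin 3) :
    Torus.gradient θ x j = partialDeriv j θ x := by
  rw [gradient_eq_sum_partialDeriv hθ]
  simp [Finset.sum_apply, Pi.single_apply]

/-! ## The bridge -/

variable {T : ℝ} {ρ : ℝ → T3 → ℝ} {u : ℝ → T3 → V3}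

/-- Slices of an isentropic solution are `C¹` torus functions. [folklore] -/
theorem isContDiff_slices_of_isentropic {γ : ℝ} (h : IsIsentropicEulerSolution γ T ρ u)
    {t : ℝ} (ht : t ∈ Ico 0 T) :
    IsContDiff 1 (ρ t) ∧ IsContDiff 1 (u t) ∧ ∀ i, IsContDiff 1 (fun y => u t y i) :=
  ⟨(h.smooth_density.isSmooth_slice ht).isContDiff (by simp),
    (h.smooth_velocity.isSmooth_slice ht).isContDiff (by simp),
    fun i => ((h.smooth_velocity.apply i).isSmooth_slice ht).isContDiff (by simp)⟩

/-- The isentropic temperature `θ = (3/5) ρ^{2/3}` of a classical isentropic solution is jointly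
smooth on `[0,T) × 𝕋³` (`ρ > 0` there). [folklore] -/
theorem isSmoothSpaceTimeOn_temperature_of_isentropic {γ : ℝ}
    (h : IsIsentropicEulerSolution γ T ρ u) :
    IsSmoothSpaceTimeOn (Ico 0 T) (fun t x => 3 / 5 * ρ t x ^ (2 / 3 : ℝ)) := by
  have h1 : ContDiffOn ℝ ∞
      (fun p : ℝ × EuclideanSpace ℝ (Fin 3) => (3 / 5 : ℝ) * stLift ρ p ^ (2 / 3 : ℝ))
      (Ico 0 T ×ˢ univ) :=
    contDiffOn_const.mul (ContDiffOn.rpow_const_of_ne h.smooth_density fun p hp =>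
      (h.density_pos p.1 (mem_prod.1 hp).1 (proj p.2)).ne')
  exact h1

/-- **Conservative momentum from the isentropic equations** (`γ = 5/3`, `θ = (3/5)ρ^{2/3}`):
`∂ₜ(ρu) + ∑ᵢ ∂ᵢ(ρuᵢ u) + ∇(hsPressure 0 ρ θ) = u (∂ₜρ + div(ρu)) + (ρ∂ₜu + ρ(u·∇)u + ∇(ρ^γ/γ)) = 0`.
[folklore] -/
theorem momentum_conservative_of_isentropic (h : IsIsentropicEulerSolution (5 / 3) T ρ u)
    {t : ℝ} (ht : t ∈ Ico 0 T) (x : T3) :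
    timeDerivWithin (Ico 0 T) (fun s y => ρ s y • u s y) t x +
      (∑ i, partialDeriv i (fun y => (ρ t y * u t y i) • u t y) x) +
      Torus.gradient (fun y => hsPressure 0 (ρ t y) (3 / 5 * ρ t y ^ (2 / 3 : ℝ))) x = 0 := by
  have hS : UniqueDiffOn ℝ (Ico (0 : ℝ) T) := uniqueDiffOn_Ico 0 T
  obtain ⟨hρ1, hu1, hui⟩ := isContDiff_slices_of_isentropic h ht
  -- the pressure is `ρ^γ/γ`
  have hp : (fun y => hsPressure 0 (ρ t y) (3 / 5 * ρ t y ^ (2 / 3 : ℝ))) =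
      fun y => ρ t y ^ (5 / 3 : ℝ) / (5 / 3) := by
    funext y
    rw [hsPressure_zero, rpow_five_thirds (h.density_pos t ht y)]
    ring
  -- `∂ₜ(ρu) = ρ ∂ₜu + (∂ₜρ) u`
  have hA : timeDerivWithin (Ico 0 T) (fun s y => ρ s y • u s y) t x =
      ρ t x • timeDerivWithin (Ico 0 T) u t x + timeDerivWithin (Ico 0 T) ρ t x • u t x :=
    ((h.smooth_density.hasDerivWithinAt_slice ht x).smul
      (h.smooth_velocity.hasDerivWithinAt_slice ht x)).derivWithin (hS t ht)
  -- `∑ᵢ ∂ᵢ(ρuᵢ u) = ρ ∑ᵢ uᵢ ∂ᵢu + div(ρu) u`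
  have hdiv : Torus.divergence (fun y => ρ t y • u t y) x =
      ∑ i, partialDeriv i (fun y => ρ t y * u t y i) x := by
    unfold Torus.divergence
    refine Finset.sum_congr rfl fun i _ => ?_
    congr 1
  have hρui : ∀ i, IsContDiff 1 (fun y => ρ t y * u t y i) := fun i => ContDiff.mul hρ1 (hui i)
  have hB : ∑ i, partialDeriv i (fun y => (ρ t y * u t y i) • u t y) x =
      ρ t x • ∑ i, u t x i • partialDeriv i (u t) x +
        (Torus.divergence (fun y => ρ t y • u t y) x) • u t x := by
    rw [hdiv, Finset.smul_sum, Finset.sum_smul, ← Finset.sum_add_distrib]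
    refine Finset.sum_congr rfl fun i _ => ?_
    rw [partialDeriv_smul (hρui i) hu1, mul_smul]
  rw [hA, hB, hp]
  have hm := h.mass t ht x
  have hmo := h.momentum t ht x
  calc ρ t x • timeDerivWithin (Ico 0 T) u t x + timeDerivWithin (Ico 0 T) ρ t x • u t x +
        (ρ t x • ∑ i, u t x i • partialDeriv i (u t) x +
          Torus.divergence (fun y => ρ t y • u t y) x • u t x) +
        Torus.gradient (fun y => ρ t y ^ (5 / 3 : ℝ) / (5 / 3)) x
      = (ρ t x • timeDerivWithin (Ico 0 T) u t x +
          ρ t x • (∑ i, u t x i • partialDeriv i (u t) x) +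
          Torus.gradient (fun y => ρ t y ^ (5 / 3 : ℝ) / (5 / 3)) x) +
        (timeDerivWithin (Ico 0 T) ρ t x + Torus.divergence (fun y => ρ t y • u t y) x) • u t x := by
        rw [add_smul]; abel
    _ = 0 := by rw [hmo, hm, zero_smul, add_zero]

/-- **Energy equation from the isentropic equations** (`γ = 5/3`, `θ = (3/5)ρ^{2/3}`,
`E = ρ|u|²/2 + (9/10)ρ^{5/3}`, `E + p = ρ|u|²/2 + (3/2)ρ^{5/3}`):
`∂ₜE + div((E+p)u) = (|u|²/2 + (3/2)ρ^{2/3})(∂ₜρ + div(ρu)) + ∑ₖ uₖ (ρ∂ₜu + ρ(u·∇)u + ∇(ρ^γ/γ))ₖ = 0`.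
[folklore] -/
theorem energy_of_isentropic (h : IsIsentropicEulerSolution (5 / 3) T ρ u)
    {t : ℝ} (ht : t ∈ Ico 0 T) (x : T3) :
    timeDerivWithin (Ico 0 T)
        (fun s y => totalEnergyDensity (ρ s y) (u s y) (3 / 5 * ρ s y ^ (2 / 3 : ℝ))) t x +
      Torus.divergence (fun y =>
        (totalEnergyDensity (ρ t y) (u t y) (3 / 5 * ρ t y ^ (2 / 3 : ℝ)) +
          hsPressure 0 (ρ t y) (3 / 5 * ρ t y ^ (2 / 3 : ℝ))) • u t y) x = 0 := by
  have hS : UniqueDiffOn ℝ (Ico (0 : ℝ) T) := uniqueDiffOn_Ico 0 T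
  obtain ⟨hρ1, hu1, -⟩ := isContDiff_slices_of_isentropic h ht
  have hr : 0 < ρ t x := h.density_pos t ht x
  -- (0) normal forms: `E = ρ(|u|²/2 + (9/10)ρ^{2/3})`, `E + p = ρ(|u|²/2 + (3/2)ρ^{2/3})`
  have hE : (fun s y => totalEnergyDensity (ρ s y) (u s y) (3 / 5 * ρ s y ^ (2 / 3 : ℝ))) =
      fun s y => ρ s y * (‖u s y‖ ^ 2 / 2 + 9 / 10 * ρ s y ^ (2 / 3 : ℝ)) := by
    funext s y
    simp only [totalEnergyDensity]
    ring
  have hEp : (fun y => (totalEnergyDensity (ρ t y) (u t y) (3 / 5 * ρ t y ^ (2 / 3 : ℝ)) +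
        hsPressure 0 (ρ t y) (3 / 5 * ρ t y ^ (2 / 3 : ℝ))) • u t y) =
      fun y => (ρ t y * (‖u t y‖ ^ 2 / 2 + 3 / 2 * ρ t y ^ (2 / 3 : ℝ))) • u t y := by
    funext y
    rw [totalEnergyDensity, hsPressure_zero]
    congr 1
    ring
  rw [hE, hEp]
  -- (1) regularity of the slices at time `t`
  have hq1 : IsContDiff 1 (fun y => ρ t y ^ (2 / 3 : ℝ)) :=
    ContDiff.rpow_const_of_ne hρ1 fun v => (h.density_pos t ht _).ne'
  have hkin : IsContDiff 1 (fun y => ‖u t y‖ ^ 2 / 2) := by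
    have : (fun y => ‖u t y‖ ^ 2 / 2) = fun y => (1 / 2 : ℝ) • ‖u t y‖ ^ 2 := by
      funext y; simp [div_eq_inv_mul]
    rw [this]
    exact (hu1.norm_sq ℝ).const_smul _
  have hg1 : IsContDiff 1 (fun y => 3 / 2 * ρ t y ^ (2 / 3 : ℝ)) := contDiff_const.mul hq1
  have hf1 : IsContDiff 1 (fun y => ‖u t y‖ ^ 2 / 2 + 3 / 2 * ρ t y ^ (2 / 3 : ℝ)) :=
    hkin.add hg1
  have hρf : IsContDiff 1
      (fun y => ρ t y * (‖u t y‖ ^ 2 / 2 + 3 / 2 * ρ t y ^ (2 / 3 : ℝ))) :=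
    ContDiff.mul hρ1 hf1
  -- (2) the time derivative of `E`
  have hd_ρ := h.smooth_density.hasDerivWithinAt_slice ht x
  have hd_u := h.smooth_velocity.hasDerivWithinAt_slice ht x
  have hd_kin : HasDerivWithinAt (fun τ => ‖u τ x‖ ^ 2 / 2)
      (∑ k, u t x k * timeDerivWithin (Ico 0 T) u t x k) (Ico 0 T) t := by
    have h1 := (hd_u.inner ℝ hd_u).div_const 2
    have heq : (fun τ => ⟪u τ x, u τ x⟫_ℝ / 2) = fun τ => ‖u τ x‖ ^ 2 / 2 := by
      funext τ; rw [real_inner_self_eq_norm_sq]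
    rw [heq] at h1
    refine h1.congr_deriv ?_
    rw [real_inner_comm, ← two_mul, mul_div_cancel_left₀ _ two_ne_zero, PiLp.inner_apply]
    exact Finset.sum_congr rfl fun k _ => by simp
  have hd_q : HasDerivWithinAt (fun τ => ρ τ x ^ (2 / 3 : ℝ))
      (timeDerivWithin (Ico 0 T) ρ t x * (2 / 3) * ρ t x ^ (2 / 3 - 1 : ℝ)) (Ico 0 T) t :=
    hd_ρ.rpow_const (Or.inl hr.ne')
  have hT : timeDerivWithin (Ico 0 T)
      (fun s y => ρ s y * (‖u s y‖ ^ 2 / 2 + 9 / 10 * ρ s y ^ (2 / 3 : ℝ))) t x =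
      timeDerivWithin (Ico 0 T) ρ t x * (‖u t x‖ ^ 2 / 2 + 9 / 10 * ρ t x ^ (2 / 3 : ℝ)) +
        ρ t x * ((∑ k, u t x k * timeDerivWithin (Ico 0 T) u t x k) +
          9 / 10 * (timeDerivWithin (Ico 0 T) ρ t x * (2 / 3) * ρ t x ^ (2 / 3 - 1 : ℝ))) :=
    (hd_ρ.fun_mul (hd_kin.add (hd_q.const_mul (9 / 10)))).derivWithin (hS t ht)
  -- (3) the space derivatives of `E + p`
  have hXf : ∀ i, partialDeriv i (fun y => ‖u t y‖ ^ 2 / 2 + 3 / 2 * ρ t y ^ (2 / 3 : ℝ)) x =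
      (∑ k, u t x k * partialDeriv i (u t) x k) +
        3 / 2 * ((2 / 3) * ρ t x ^ (2 / 3 - 1 : ℝ)) * partialDeriv i (ρ t) x := fun i => by
    rw [partialDeriv_add_apply hkin hg1 i x, partialDeriv_half_norm_sq hu1,
      partialDeriv_comp_of_hasDerivAt (φ := fun r => 3 / 2 * r ^ (2 / 3 : ℝ)) hρ1 x
        ((Real.hasDerivAt_rpow_const (Or.inl hr.ne')).const_mul (3 / 2)) i]
    simp_rw [partialDeriv_apply_coord hu1]
  have hXρf : ∀ i,
      partialDeriv i (fun y => ρ t y * (‖u t y‖ ^ 2 / 2 + 3 / 2 * ρ t y ^ (2 / 3 : ℝ))) x =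
      ρ t x * ((∑ k, u t x k * partialDeriv i (u t) x k) +
          3 / 2 * ((2 / 3) * ρ t x ^ (2 / 3 - 1 : ℝ)) * partialDeriv i (ρ t) x) +
        partialDeriv i (ρ t) x * (‖u t x‖ ^ 2 / 2 + 3 / 2 * ρ t x ^ (2 / 3 : ℝ)) := fun i => by
    rw [partialDeriv_mul hρ1 hf1, hXf i]
  -- (4) mass and momentum at the point, in coordinates
  have hdivu : Torus.divergence (u t) x = ∑ i, partialDeriv i (u t) x i :=
    divergence_eq_sum_partialDeriv_apply hu1 x
  have hMa := h.mass t ht x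
  rw [divergence_smul hρ1 hu1 x, hdivu] at hMa
  have hP1 : IsContDiff 1 (fun y => ρ t y ^ (5 / 3 : ℝ) / (5 / 3)) :=
    (ContDiff.rpow_const_of_ne hρ1 fun v => (h.density_pos t ht _).ne').div_const _
  have hMo : ∀ k, ρ t x * timeDerivWithin (Ico 0 T) u t x k +
      ρ t x * (∑ i, u t x i * partialDeriv i (u t) x k) +
      ρ t x ^ (2 / 3 : ℝ) * partialDeriv k (ρ t) x = 0 := by
    intro k
    have hmk := congrArg (fun v : V3 => v k) (h.momentum t ht x)
    have hPk : Torus.gradient (fun y => ρ t y ^ (5 / 3 : ℝ) / (5 / 3)) x k =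
        ρ t x ^ (2 / 3 : ℝ) * partialDeriv k (ρ t) x := by
      rw [gradient_apply_coord hP1 x k,
        partialDeriv_comp_of_hasDerivAt (φ := fun r => r ^ (5 / 3 : ℝ) / (5 / 3)) hρ1 x
          ((Real.hasDerivAt_rpow_const (Or.inr (by norm_num))).div_const (5 / 3)) k]
      congr 1
      rw [show (5 / 3 - 1 : ℝ) = 2 / 3 by norm_num]
      ring
    simpa only [PiLp.add_apply, PiLp.smul_apply, PiLp.zero_apply, smul_eq_mul, WithLp.ofLp_sum,
      Finset.sum_apply, hPk, Finset.mul_sum] using hmk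
  -- (5) assemble: `f · (mass) + ∑ₖ uₖ · (momentum)ₖ` with `ρ^{2/3-1} ρ = ρ^{2/3}`
  have hm : ρ t x ^ (2 / 3 - 1 : ℝ) * ρ t x = ρ t x ^ (2 / 3 : ℝ) :=
    rpow_two_thirds_sub_one_mul hr
  rw [hT, divergence_smul hρf hu1 x, hdivu]
  simp only [hXρf, Fin.sum_univ_three] at hMa hMo ⊢
  have hMo0 := hMo 0
  have hMo1 := hMo 1
  have hMo2 := hMo 2
  linear_combination (‖u t x‖ ^ 2 / 2 + 3 / 2 * ρ t x ^ (2 / 3 : ℝ)) * hMa +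
    u t x 0 * hMo0 + u t x 1 * hMo1 + u t x 2 * hMo2 +
    (3 / 5 * timeDerivWithin (Ico 0 T) ρ t x +
      (u t x 0 * partialDeriv 0 (ρ t) x + u t x 1 * partialDeriv 1 (ρ t) x +
        u t x 2 * partialDeriv 2 (ρ t) x)) * hm

/-- **The isentropic → full ideal-gas bridge.** A classical solution `(ρ, u)` of the isentropic
compressible Euler system with adiabatic exponent `γ = 5/3` on `[0, T) × 𝕋³`
(`Literature.Analysis.FluidPDE.IsIsentropicEulerSolution`, the form in which the
Cao-Labora–Gómez-Serrano–Shi–Staffilani implosion is vendored) is, together with the isentropic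
temperature `θ := (3/5) ρ^{2/3}` (so that `p = ρ θ = ρ^γ/γ` and `E = ρ(|u|²/2 + 3θ/2)`), a classical
solution of the FULL hard-sphere compressible Euler system at reduced density `σ = 0` (monatomic
ideal gas, `hsPressure 0 ρ θ = ρ θ`): `IsHardSphereEulerSolution 0 T ρ u θ`. [folklore] -/
theorem isHardSphereEulerSolution_zero_of_isentropic :
    ∀ {T : ℝ} {ρ : ℝ → T3 → ℝ} {u : ℝ → T3 → V3},
      Literature.Analysis.FluidPDE.IsIsentropicEulerSolution (5 / 3) T ρ u →
        IsHardSphereEulerSolution 0 T ρ u (fun t x => 3 / 5 * ρ t x ^ (2 / 3 : ℝ)) := by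
  intro T ρ u h
  exact
    { smooth_density := h.smooth_density
      smooth_velocity := h.smooth_velocity
      smooth_temperature := isSmoothSpaceTimeOn_temperature_of_isentropic h
      density_pos := h.density_pos
      temperature_pos := fun t ht x =>
        mul_pos (by norm_num) (Real.rpow_pos_of_pos (h.density_pos t ht x) _)
      mass := h.mass
      momentum := fun t ht x => momentum_conservative_of_isentropic h ht x
      energy := fun t ht x => energy_of_isentropic h ht x }

end Summit.AtomisticToContinuum.HydrodynamicLimit.Theorems

end
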